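import Summits.Ventures.CertifiedManyBodySolver.Rows.CorrWindowCertKernelChainQuot
import Summits.Ventures.CertifiedManyBodySolver.Rows.KernelPosTree
import HarnessLib

/-!
# CODED HINT ROWS: one numeral per hint + one class table per certificate (hint bytes ÷ 4–6), decoded by the kernel through the
# positional tree — NO theorem needed, because hints are untrusted and re-checked by `rowOK`

HONEST FRAMING: Lean plumbing towards «tier P» (cell hubbard-obs; successor item (2)/(3) of HOME/HANDOFF «obs-p2 v23.0»: «packed hint
sidecars if the byte budget binds»). MEASURED (algo-p2 W1 j320306): ≈ 7.9·10⁵ hint rows per Rm2 certificate, ≤ 10 747 per step, but only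
7 313 canonical CLASSES; a textual `QHint` row is ≈ 50–100 B (≈ 27 MB/cert, > 512 KB for the largest steps). Since the hinted step
`stepEQ`/`stepEQA` RE-CHECKS every hint (`rowOK`) and the closers quantify over ARBITRARY hint lists, the encoding of hints carries no proof
obligation at all: here a hint is ONE natural `code = ((cls·16 + (v₁+8))·16 + (v₂+8))·8 + γ` (class id, shift in `[−8, 7]²`, `D₄` code) and
the class representatives `reps : List (Mono (Orb (Fin Nβ)))` are emitted ONCE per certificate; `hintsOfCodes Dr reps codes` decodes a step's
list through `PTree` (`Rows/KernelPosTree.lean`, ≈ log₂|reps| node steps per hint). ≈ 8–10 B per hint ⇒ ≈ 100 KB for the largest step. A wrong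
code costs nothing but a rejected hint. Nothing of record; no summit statement is proved by this file. Seat hubbard-obs-p2 (STIFFNESS),
`prover-hubbard-obs-p2-g24-0`, zero compute.

References: X. Han, arXiv:2006.06002 §3 (orbit variables / symmetry identifications) [Han2020Bootstrap]; C. Okasaki, *Purely Functional Data
Structures* (CUP 1998) §9.2 [Okasaki1998].
-/

namespace Summit.Ventures.CertifiedManyBodySolver

namespace CARPolyWindow

open Summit.Ventures.CertifiedQuantumChemistry Summit.Ventures.CertifiedQuantumChemistry.CARPoly
open Literature.MathematicalPhysics.QuantumLattice Literature.MathematicalPhysics.QuantumLattice.HubbardWave0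

section HintCode

variable {Nβ : ℕ}

/-- **Decode one hint**: `code = ((cls·16 + (v₁+8))·16 + (v₂+8))·8 + γ`; the class representative is read through the depth-`Dr` tree over
`reps` (falls back to the list beyond `2^Dr`; an out-of-range class id decodes to the empty monomial, which `rowOK` rejects). [cite: Han2020Bootstrap, §3] -/
def hintOfCode (Dr : ℕ) (t : PTree (CARPoly.Mono (Orb (Fin Nβ)))) (reps : List (CARPoly.Mono (Orb (Fin Nβ)))) (code : ℕ) : QHint Nβ :=
  ⟨Fin.ofNat 8 (code % 8), (((code / 128) % 16 : ℕ) - (8 : ℤ), ((code / 8) % 16 : ℕ) - (8 : ℤ)), PTree.lookup Dr t reps (code / 2048) ([], [])⟩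

/-- **Decode a step's hint list** (the tree over `reps` is built once per declaration: the term is closed and shared). [folklore] -/
def hintsOfCodes (Dr : ℕ) (reps : List (CARPoly.Mono (Orb (Fin Nβ)))) (codes : List ℕ) : List (QHint Nβ) :=
  codes.map (hintOfCode Dr (PTree.build Dr reps).1 reps)

/-- The encoder an exporter uses (for documentation and round-trip tests): shift components must lie in `[−8, 7]`. [folklore] -/
def codeOfHint (cls : ℕ) (v : ℤ × ℤ) (γ : Fin 8) : ℕ := ((cls * 16 + (v.1 + 8).toNat) * 16 + (v.2 + 8).toNat) * 8 + γ.val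

/-- Round trip on a toy table (class 2 of three, shift `(−3, 7)`, code `γ = 5`). [folklore] -/
example : ((hintsOfCodes (Nβ := 9) 2 [([orb 0 0], []), ([], [orb 1 1]), ([orb 2 0], [orb 3 1])] [codeOfHint 2 (-3, 7) 5]).map
    fun h => (h.γ.val, h.v, (h.μ.1.map fun l => (ofLex l).1.val), (h.μ.2.map fun l => (ofLex l).1.val))) = [(5, (-3, 7), [2], [3])] := by
  decide

end HintCode

end CARPolyWindow

end Summit.Ventures.CertifiedManyBodySolver
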